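import Summits.QuantumFields.YangMills.Theorems.TunedSequenceExists.Negative.Glue
import Summits.QuantumFields.YangMills.Theorems.LangevinControlUVFemtoCurvatureTwoPointAxisProfileAntitone
import Summits.QuantumFields.YangMills.Theorems.EquipartitionCriticalityRPProbeCriticalityOddLimit

/-!
# Crux `TunedSequenceExists` (stmt-QuantumFields-10524), line `fixed-aspect-window`, lead c3:
# the RP-DIAGONAL VARIANT — what changes if (S) is tuned by a time-zero plaquette instead of the
# corner action density (kernel-checked certificate for the planners; not a proof of the crux)

The crux tunes Wilson schemes by the connected correlator of the CORNER action density
`P = r.curvature.F = Σ_{i<j} Re tr r(U_{p_ij(0)})`, which straddles the time slices `0, 1`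
(three temporal plaquettes).  Lead c2 showed (`RPStraddleCounterexample.lean`) that `⟨P ; τ_n P⟩` is
NOT a reflection-positivity-diagonal quantity, and the wave-1 worker on stub (A) showed that the
canonical upper bound (A) for `P` carries infrared content of its own.  This file records,
kernel-checked, what the SAME statement looks like for the time-zero observable

  `Q := Re tr r(U_{p_{12}(0)})` (one spatial plaquette at the origin, `spatialPlaquette r`):

* `latticeConnectedCorr_spatialPlaquette_nonneg` — `0 ≤ ⟨Q ; τ_n Q⟩_{β, S}` for every compact `G`,
  every `r`, every side `S`, every `β ≥ 0`, every `n` (landed RP: `AxisCovNonneg.timeAxisCov_nonneg`);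
* `latticeConnectedCorr_spatialPlaquette_antitone` — `n ↦ ⟨Q ; τ_n Q⟩_{β, S}` is non-increasing on
  `2n ≤ S` (landed transfer monotonicity: `AxisCovNonneg.axisProfile_antitone`);
* hence clause (iii) of the crux is FREE for `Q`: `0 ≤ N_t(k) ≤ N_1(k)` whenever `2 t M^{n_k} ≤ side`
  (`rescaled_nonneg`, `rescaled_mul_le`) — no stub (A) is needed;
* `latticeConnectedCorr_spatialPlaquette_tendsto_zero` / `continuous_latticeConnectedCorr_spatialPlaquette`
  — freezing and β-continuity for `Q` (same Laplace engine as for `P`);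
* `volumeMonotoneQ_on_finset` — for `Q`, the volume quasi-monotonicity (V) restricted to ANY FINITE
  set of depths holds trivially (freezing on the small torus + non-negativity on the big one): the
  content of (V) for an RP-diagonal observable is purely the uniformity in the depth `m` at the
  tuned crossover (the continuum finite-size effect at aspect `L₁`), nothing else;
* `TunedSequenceExistsQ` — the text of (S) with `Q` in place of `P`, and
  `tunedSequenceExistsQ_of : FemtoWindowQAll → VolumeMonotoneQAll → TunedSequenceExistsQ` — a
  TWO-child split with no upper-bound child, sorry-free.

Physics is unchanged (the tuning pin is any canonically normalised gauge-invariant dimension-4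
two-point function; `⟨tr B²(0) tr B²(t e₀)⟩` is the scalar channel).  Whether to restate (S) — and the
tuning hypotheses of (A) `ContinuumLimitOnTrajectory` / (B) `LatticeGapOnTrajectory` that consume the
tuned scheme — is the planners' decision; this file only certifies the gain.
-/

noncomputable section

open Filter Topology MeasureTheory
open Literature.MathematicalPhysics.QuantumFieldTheory Literature.MathematicalPhysics.QuantumLattice
open Summit.QuantumFields.YangMills.Theorems.TunedSequenceExists.Negative.Freezing
open Summit.QuantumFields.YangMills.Theorems.TunedSequenceExists.Negative.Glue
  (continuous_integral_wilsonMeasure)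
open Summit.QuantumFields.YangMills.Theorems.TunedSequenceExists.Negative.AtZeroFalse
  (eventually_sep_le_L)
open Summit.QuantumFields.YangMills.Theorems.FemtoCurvatureTwoPoint.AxisCovNonneg
  (timeAxisCov_nonneg axisProfile_antitone plaqRe_torusConfigShift)
open Summit.QuantumFields.YangMills.Theorems.EquipartitionCriticality.RPProbe
  (torusProj_zero torusProj_single_zero)

namespace Summit.QuantumFields.YangMills.Cruxes.TunedSequenceExists.RPDiagonalVariant

/-- The spatial coordinate plane `(1, 2)` of `ℤ⁴` (time is direction `0`). -/
def q12 : {p : Fin 4 × Fin 4 // p.1 < p.2} := ⟨((1 : Fin 4), (2 : Fin 4)), by decide⟩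

variable {G : Type} [Group G] [TopologicalSpace G] [IsTopologicalGroup G] [CompactSpace G]
  [MeasurableSpace G] [BorelSpace G]

/-- `Q := Re tr r(U_{p_{12}(0)})` — the time-zero spatial plaquette at the origin, as an observable
of the infinite lattice (read on periodic configurations through `torusLift`). -/
def spatialPlaquette (r : LatticeRep G) : LGConfig 4 G → ℝ := plaquetteObs r.ρ 0 1 2

/-! ## Bridge to torus coordinates -/

omit [IsTopologicalGroup G] [CompactSpace G] [MeasurableSpace G] [BorelSpace G] in
theorem spatialPlaquette_torusLift (r : LatticeRep G) (S : ℕ) (U : GaugeConfig 4 S G) :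
    spatialPlaquette r (torusLift S U) = WilsonRP.plaqRe r.ρ U ((0 : Site 4 S), q12) := by
  simp only [spatialPlaquette, plaquetteObs, plaquetteHolonomyZd_torusLift', WilsonRP.plaqRe, q12,
    torusProj_zero]

omit [IsTopologicalGroup G] [CompactSpace G] [BorelSpace G] in
theorem spatialPlaquette_configShift_torusLift (r : LatticeRep G) (S n : ℕ) (U : GaugeConfig 4 S G) :
    spatialPlaquette r (configShift (-Pi.single 0 (n : ℤ)) (torusLift S U)) =
      WilsonRP.plaqRe r.ρ U ((Pi.single (0 : Fin 4) ((n : ℕ) : ZMod S) : Site 4 S), q12) := by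
  simp only [spatialPlaquette, plaquetteObs, plaquetteHolonomyZd_configShift,
    plaquetteHolonomyZd_torusLift', WilsonRP.plaqRe, q12, zero_sub, neg_neg, torusProj_single_zero]

/-- Translation invariance of the one-point function along the time axis. -/
theorem wilsonExpectation_plaqRe_single (r : LatticeRep G) (β : ℝ) (S : ℕ) [NeZero S] (n : ℕ) :
    wilsonExpectation r.ρ β (fun U : GaugeConfig 4 S G =>
        WilsonRP.plaqRe r.ρ U ((Pi.single (0 : Fin 4) ((n : ℕ) : ZMod S) : Site 4 S), q12)) =
      wilsonExpectation r.ρ β (fun U : GaugeConfig 4 S G =>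
        WilsonRP.plaqRe r.ρ U ((0 : Site 4 S), q12)) := by
  have h := wilsonExpectation_comp_torusConfigShift (d := 4) r.ρ β
    (Pi.single (0 : Fin 4) ((n : ℕ) : ZMod S) : Site 4 S)
    (fun U : GaugeConfig 4 S G =>
      WilsonRP.plaqRe r.ρ U ((Pi.single (0 : Fin 4) ((n : ℕ) : ZMod S) : Site 4 S), q12))
  simp only [Function.comp_def, plaqRe_torusConfigShift, sub_self] at h
  exact h.symm

/-- **Bridge.** The crux-format connected correlator of `Q` is the axis covariance profile of the
landed RP files (the crux subtracts the unshifted mean; translation invariance identifies the two). -/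
theorem latticeConnectedCorr_spatialPlaquette_eq (r : LatticeRep G) (β : ℝ) (S : ℕ) [NeZero S]
    (n : ℕ) :
    latticeConnectedCorr r.ρ β S (spatialPlaquette r) (spatialPlaquette r) n =
      wilsonExpectation r.ρ β (fun U : GaugeConfig 4 S G =>
          WilsonRP.plaqRe r.ρ U ((0 : Site 4 S), q12) *
            WilsonRP.plaqRe r.ρ U ((Pi.single (0 : Fin 4) ((n : ℕ) : ZMod S) : Site 4 S), q12))
        - wilsonExpectation r.ρ β (fun U : GaugeConfig 4 S G =>
            WilsonRP.plaqRe r.ρ U ((0 : Site 4 S), q12))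
          * wilsonExpectation r.ρ β (fun U : GaugeConfig 4 S G =>
            WilsonRP.plaqRe r.ρ U ((Pi.single (0 : Fin 4) ((n : ℕ) : ZMod S) : Site 4 S), q12)) := by
  rw [wilsonExpectation_plaqRe_single]
  simp only [latticeConnectedCorr, wilsonExpectation, spatialPlaquette_torusLift,
    spatialPlaquette_configShift_torusLift]

/-! ## Reflection positivity and transfer monotonicity (landed), in crux format -/

/-- **`0 ≤ ⟨Q ; τ_n Q⟩_{β, S}`** for every compact `G`, every `r`, every side, every `β ≥ 0`. -/
theorem latticeConnectedCorr_spatialPlaquette_nonneg (r : LatticeRep G) {β : ℝ} (hβ : 0 ≤ β)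
    (S : ℕ) [NeZero S] (n : ℕ) :
    0 ≤ latticeConnectedCorr r.ρ β S (spatialPlaquette r) (spatialPlaquette r) n := by
  rw [latticeConnectedCorr_spatialPlaquette_eq]
  exact timeAxisCov_nonneg (d := 3) r.ρ r.continuous hβ q12 (by decide) n

/-- **`n ↦ ⟨Q ; τ_n Q⟩_{β, S}` is non-increasing on the half torus** (`k ≤ n`, `2n ≤ S`). -/
theorem latticeConnectedCorr_spatialPlaquette_antitone (r : LatticeRep G) {β : ℝ} (hβ : 0 ≤ β)
    (S : ℕ) [NeZero S] {k n : ℕ} (hkn : k ≤ n) (hn : 2 * n ≤ S) :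
    latticeConnectedCorr r.ρ β S (spatialPlaquette r) (spatialPlaquette r) n ≤
      latticeConnectedCorr r.ρ β S (spatialPlaquette r) (spatialPlaquette r) k := by
  simp only [latticeConnectedCorr_spatialPlaquette_eq]
  exact axisProfile_antitone (d := 3) r.ρ r.continuous hβ q12 (by decide) _ rfl hkn hn

/-- **Clause (iii) is free for `Q`, lower half**: `0 ≤ N_t`. -/
theorem rescaled_nonneg (r : LatticeRep G) {β : ℝ} (hβ : 0 ≤ β) (M m L n : ℕ) :
    0 ≤ ((M : ℝ) ^ m) ^ 8 *
      latticeConnectedCorr r.ρ β (2 * L + 1) (spatialPlaquette r) (spatialPlaquette r) n :=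
  mul_nonneg (by positivity) (latticeConnectedCorr_spatialPlaquette_nonneg r hβ _ n)

/-- **Clause (iii) is free for `Q`, upper half**: `N_t ≤ N_1` as soon as `2 t M^m ≤ 2L+1`, `t ≥ 1`. -/
theorem rescaled_mul_le (r : LatticeRep G) {β : ℝ} (hβ : 0 ≤ β) (M m L t : ℕ) (ht : 1 ≤ t)
    (htL : 2 * (t * M ^ m) ≤ 2 * L + 1) :
    ((M : ℝ) ^ m) ^ 8 *
        latticeConnectedCorr r.ρ β (2 * L + 1) (spatialPlaquette r) (spatialPlaquette r) (t * M ^ m) ≤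
      ((M : ℝ) ^ m) ^ 8 *
        latticeConnectedCorr r.ρ β (2 * L + 1) (spatialPlaquette r) (spatialPlaquette r) (M ^ m) :=
  mul_le_mul_of_nonneg_left
    (latticeConnectedCorr_spatialPlaquette_antitone r hβ _ (Nat.le_mul_of_pos_left _ ht) htL)
    (by positivity)

/-! ## Freezing and β-continuity for `Q` (same engine as for the corner density) -/

/-- **Freezing**: `⟨Q ; τ_m Q⟩_{β, S} → 0` as `β → ∞` on a fixed torus. -/
theorem latticeConnectedCorr_spatialPlaquette_tendsto_zero (r : LatticeRep G) (S : ℕ) [NeZero S]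
    (m : ℕ) :
    Tendsto (fun β : ℝ => latticeConnectedCorr r.ρ β S (spatialPlaquette r) (spatialPlaquette r) m)
      atTop (𝓝 0) := by
  haveI : SecondCountableTopology G := secondCountable_of_latticeRep r
  have hρN : ∀ g, (r.ρ g).trace.re ≤ r.N := fun g => re_trace_le_of_mem_unitaryGroup (r.mem_unitary g)
  have hA : Continuous fun U : GaugeConfig 4 S G => WilsonRP.plaqRe r.ρ U ((0 : Site 4 S), q12) :=
    (continuous_trace_re r.ρ r.continuous).comp (continuous_plaquetteHolonomy _ _ _)
  have hB : Continuous fun U : GaugeConfig 4 S G =>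
      WilsonRP.plaqRe r.ρ U ((Pi.single (0 : Fin 4) ((m : ℕ) : ZMod S) : Site 4 S), q12) :=
    (continuous_trace_re r.ρ r.continuous).comp (continuous_plaquetteHolonomy _ _ _)
  have hflat : ∀ (U : GaugeConfig 4 S G), wilsonAction r.ρ U = 0 → ∀ x : Site 4 S,
      WilsonRP.plaqRe r.ρ U (x, q12) = r.N := fun U hU x =>
    re_trace_eq_of_wilsonAction_eq_zero r.ρ hρN hU x 1 2 (by decide)
  have h1 := tendsto_integral_wilsonMeasure r.ρ r.continuous hρN (hA.mul hB)
    (c := (r.N : ℝ) * r.N) fun U hU => by simp only [Pi.mul_apply, hflat U hU]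
  have h2 := tendsto_integral_wilsonMeasure r.ρ r.continuous hρN hA (c := (r.N : ℝ))
    fun U hU => hflat U hU _
  have h3 := tendsto_integral_wilsonMeasure r.ρ r.continuous hρN hB (c := (r.N : ℝ))
    fun U hU => hflat U hU _
  have h := h1.sub (h2.mul h3)
  rw [sub_self] at h
  simp only [Pi.mul_apply] at h
  simpa only [latticeConnectedCorr_spatialPlaquette_eq, wilsonExpectation] using h

/-- **β-continuity** of `β ↦ ⟨Q ; τ_m Q⟩_{β, S}` on a fixed torus. -/
theorem continuous_latticeConnectedCorr_spatialPlaquette (r : LatticeRep G) (S : ℕ) [NeZero S]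
    (m : ℕ) :
    Continuous fun β : ℝ =>
      latticeConnectedCorr r.ρ β S (spatialPlaquette r) (spatialPlaquette r) m := by
  haveI : SecondCountableTopology G := secondCountable_of_latticeRep r
  have hA : Continuous fun U : GaugeConfig 4 S G => WilsonRP.plaqRe r.ρ U ((0 : Site 4 S), q12) :=
    (continuous_trace_re r.ρ r.continuous).comp (continuous_plaquetteHolonomy _ _ _)
  have hB : Continuous fun U : GaugeConfig 4 S G =>
      WilsonRP.plaqRe r.ρ U ((Pi.single (0 : Fin 4) ((m : ℕ) : ZMod S) : Site 4 S), q12) :=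
    (continuous_trace_re r.ρ r.continuous).comp (continuous_plaquetteHolonomy _ _ _)
  have h1 := continuous_integral_wilsonMeasure r.ρ r.continuous (hA.mul hB)
  have h2 := continuous_integral_wilsonMeasure r.ρ r.continuous hA
  have h3 := continuous_integral_wilsonMeasure r.ρ r.continuous hB
  simp only [latticeConnectedCorr_spatialPlaquette_eq, wilsonExpectation]
  exact h1.sub (h2.mul h3)

/-! ## (V) for `Q` restricted to finitely many depths is free -/

/-- **Volume quasi-monotonicity for `Q` on any FINITE set of depths** (freezing on the small tori
+ non-negativity on the big ones): the content of (V) for an RP-diagonal observable is only the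
uniformity in the depth `m`. -/
theorem volumeMonotoneQ_on_finset (r : LatticeRep G) (M L₁ : ℕ) (hL₁ : 2 ≤ L₁) (F : Finset ℕ)
    {c : ℝ} (hc : 0 < c) :
    ∃ β₁ : ℝ, ∀ β : ℝ, β₁ ≤ β → ∀ m ∈ F, ∀ L : ℕ, L₁ * M ^ m ≤ L →
      ((M : ℝ) ^ m) ^ 8 *
          latticeConnectedCorr r.ρ β (2 * (L₁ * M ^ m) + 1) (spatialPlaquette r) (spatialPlaquette r)
            (M ^ m) - c / Real.log L₁ ^ 2 ≤
        ((M : ℝ) ^ m) ^ 8 *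
          latticeConnectedCorr r.ρ β (2 * L + 1) (spatialPlaquette r) (spatialPlaquette r) (M ^ m) := by
  have hlog : 0 < Real.log L₁ := Real.log_pos (by exact_mod_cast hL₁)
  have hpos : (0 : ℝ) < c / Real.log L₁ ^ 2 := div_pos hc (pow_pos hlog 2)
  have hsmall : ∀ᶠ β : ℝ in atTop, ∀ m ∈ F, ((M : ℝ) ^ m) ^ 8 *
      latticeConnectedCorr r.ρ β (2 * (L₁ * M ^ m) + 1) (spatialPlaquette r) (spatialPlaquette r)
        (M ^ m) < c / Real.log L₁ ^ 2 := by
    refine (F.eventually_all).2 fun m _ => ?_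
    have h := (latticeConnectedCorr_spatialPlaquette_tendsto_zero r (2 * (L₁ * M ^ m) + 1)
      (M ^ m)).const_mul (((M : ℝ) ^ m) ^ 8)
    rw [mul_zero] at h
    exact h.eventually_lt_const hpos
  obtain ⟨B, hB⟩ := eventually_atTop.1 hsmall
  refine ⟨max B 0, fun β hβ m hm L _ => ?_⟩
  have h1 := hB β ((le_max_left _ _).trans hβ) m hm
  have h2 := rescaled_nonneg r ((le_max_right _ _).trans hβ) M m L (M ^ m)
  linarith

/-! ## The restated crux `(S_Q)` and its TWO-child split (no upper-bound child) -/

/-- **(U_Q)** — the pinned-aspect window for `Q` (same shape as stub `stub_femtoWindow`). -/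
def FemtoWindowQ (r : LatticeRep G) (M : ℕ) : Prop :=
  ∃ c : ℝ, 0 < c ∧ ∃ LU : ℕ, ∀ L₁ : ℕ, LU ≤ L₁ → 2 ≤ L₁ → ∀ (B : ℝ) (m₀ : ℕ),
    ∃ m : ℕ, m₀ ≤ m ∧ ∃ β : ℝ, B ≤ β ∧
      c / Real.log L₁ ^ 2 ≤ ((M : ℝ) ^ m) ^ 8 *
        latticeConnectedCorr r.ρ β (2 * (L₁ * M ^ m) + 1) (spatialPlaquette r) (spatialPlaquette r)
          (M ^ m)

/-- **(V_Q)** — one-sided volume quasi-monotonicity for `Q` (same shape as `stub_volumeMonotone`). -/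
def VolumeMonotoneQ (r : LatticeRep G) (M : ℕ) : Prop :=
  ∀ c : ℝ, 0 < c → ∃ LV : ℕ, ∀ L₁ : ℕ, LV ≤ L₁ → 2 ≤ L₁ → ∃ (β₁ : ℝ) (m₁ : ℕ),
    ∀ (β : ℝ) (m L : ℕ), β₁ ≤ β → m₁ ≤ m → L₁ * M ^ m ≤ L →
      ((M : ℝ) ^ m) ^ 8 *
          latticeConnectedCorr r.ρ β (2 * (L₁ * M ^ m) + 1) (spatialPlaquette r) (spatialPlaquette r)
            (M ^ m) - c / Real.log L₁ ^ 2 ≤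
      ((M : ℝ) ^ m) ^ 8 *
          latticeConnectedCorr r.ρ β (2 * L + 1) (spatialPlaquette r) (spatialPlaquette r) (M ^ m)

/-- **(S_Q)** — the crux text with the time-zero plaquette `Q` in place of the corner density `P`. -/
def TunedSequenceExistsQ : Prop :=
  ∀ (G : Type) [Group G] [TopologicalSpace G] [IsTopologicalGroup G] [CompactSpace G],
    IsCompactSimpleLieGroup G → letI : MeasurableSpace G := borel G
    haveI : BorelSpace G := ⟨rfl⟩
    ∀ (r : LatticeRep G) (M : ℕ), 2 ≤ M → ∃ θ₀ : ℝ, 0 < θ₀ ∧ ∀ θ : ℝ, 0 < θ → θ < θ₀ →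
      ∃ (sch : SpeciesScheme (YMSpecies G)) (n : ℕ → ℕ),
        (∀ k, sch.a k = ((M : ℝ) ^ n k)⁻¹) ∧ Tendsto sch.β atTop atTop ∧
        (∀ t : ℕ, 0 < t → ∃ c : ℝ, Tendsto (fun k => ((M : ℝ) ^ n k) ^ 8 *
            latticeConnectedCorr r.ρ (sch.β k) (sch.side k) (spatialPlaquette r)
              (spatialPlaquette r) (t * M ^ n k)) atTop (𝓝 c)) ∧
        Tendsto (fun k => ((M : ℝ) ^ n k) ^ 8 *
            latticeConnectedCorr r.ρ (sch.β k) (sch.side k) (spatialPlaquette r)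
              (spatialPlaquette r) (M ^ n k)) atTop (𝓝 θ)

/-- (U_Q) under the crux prefix. -/
def FemtoWindowQAll : Prop :=
  ∀ (G : Type) [Group G] [TopologicalSpace G] [IsTopologicalGroup G] [CompactSpace G],
    IsCompactSimpleLieGroup G → letI : MeasurableSpace G := borel G
    haveI : BorelSpace G := ⟨rfl⟩
    ∀ (r : LatticeRep G) (M : ℕ), 2 ≤ M → FemtoWindowQ r M

/-- (V_Q) under the crux prefix. -/
def VolumeMonotoneQAll : Prop :=
  ∀ (G : Type) [Group G] [TopologicalSpace G] [IsTopologicalGroup G] [CompactSpace G],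
    IsCompactSimpleLieGroup G → letI : MeasurableSpace G := borel G
    haveI : BorelSpace G := ⟨rfl⟩
    ∀ (r : LatticeRep G) (M : ℕ), 2 ≤ M → VolumeMonotoneQ r M

section GlueQ

/-- (U_Q) + (V_Q) ⇒ the window lower bound for `Q` (quantifier arithmetic, observable-agnostic). -/
theorem lowerBoundQ_of_femto_of_volume (r : LatticeRep G) {M : ℕ} (hU : FemtoWindowQ r M)
    (hV : VolumeMonotoneQ r M) :
    ∃ θ₀ : ℝ, 0 < θ₀ ∧ ∀ (B : ℝ) (m₀ L₀ : ℕ), ∃ m : ℕ, m₀ ≤ m ∧ ∃ L : ℕ, L₀ * M ^ m ≤ L ∧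
      ∃ β : ℝ, B ≤ β ∧ θ₀ ≤ ((M : ℝ) ^ m) ^ 8 *
        latticeConnectedCorr r.ρ β (2 * L + 1) (spatialPlaquette r) (spatialPlaquette r) (M ^ m) := by
  obtain ⟨c, hc, LU, hU⟩ := hU
  obtain ⟨LV, hV⟩ := hV (c / 2) (half_pos hc)
  set L₁ : ℕ := max (max LU LV) 2 with hL₁
  have hLU : LU ≤ L₁ := (le_max_left _ _).trans (le_max_left _ _)
  have hLV : LV ≤ L₁ := (le_max_right _ _).trans (le_max_left _ _)
  have h2 : 2 ≤ L₁ := le_max_right _ _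
  have hlog : 0 < Real.log (L₁ : ℝ) := Real.log_pos (by exact_mod_cast h2)
  obtain ⟨β₁, m₁, hV'⟩ := hV L₁ hLV h2
  refine ⟨c / 2 / Real.log L₁ ^ 2, by positivity, fun B m₀ L₀ => ?_⟩
  obtain ⟨m, hm, β, hβ, hu⟩ := hU L₁ hLU h2 (max B β₁) (max m₀ m₁)
  refine ⟨m, (le_max_left _ _).trans hm, max L₀ L₁ * M ^ m,
    Nat.mul_le_mul_right _ (le_max_left _ _), β, (le_max_left _ _).trans hβ, ?_⟩
  have hstep := hV' β m (max L₀ L₁ * M ^ m) ((le_max_right _ _).trans hβ)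
    ((le_max_right _ _).trans hm) (Nat.mul_le_mul_right _ (le_max_right _ _))
  have hhalf : c / 2 / Real.log (L₁ : ℝ) ^ 2 = c / Real.log L₁ ^ 2 - c / 2 / Real.log L₁ ^ 2 := by
    ring
  linarith

/-- Exact tuning at one lattice for `Q` (continuity + freezing + IVT). -/
theorem exists_ge_corrQ_eq (r : LatticeRep G) (M m L : ℕ) {θ θ₀ βstar : ℝ} (hθ : 0 < θ)
    (hθθ₀ : θ < θ₀) (hstar : θ₀ ≤ ((M : ℝ) ^ m) ^ 8 *
      latticeConnectedCorr r.ρ βstar (2 * L + 1) (spatialPlaquette r) (spatialPlaquette r) (M ^ m)) :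
    ∃ β : ℝ, βstar ≤ β ∧ ((M : ℝ) ^ m) ^ 8 *
      latticeConnectedCorr r.ρ β (2 * L + 1) (spatialPlaquette r) (spatialPlaquette r) (M ^ m) = θ := by
  set f : ℝ → ℝ := fun β => ((M : ℝ) ^ m) ^ 8 *
    latticeConnectedCorr r.ρ β (2 * L + 1) (spatialPlaquette r) (spatialPlaquette r) (M ^ m) with hf
  have hfc : Continuous f :=
    continuous_const.mul (continuous_latticeConnectedCorr_spatialPlaquette r (2 * L + 1) (M ^ m))
  have hlim : Tendsto f atTop (𝓝 0) := by
    have := (latticeConnectedCorr_spatialPlaquette_tendsto_zero r (2 * L + 1) (M ^ m)).const_mul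
      (((M : ℝ) ^ m) ^ 8)
    rwa [mul_zero] at this
  obtain ⟨β₂, hβ₂⟩ := eventually_atTop.1 ((hlim.eventually (gt_mem_nhds hθ)).and
    (eventually_ge_atTop βstar))
  obtain ⟨hlt, hge⟩ := hβ₂ β₂ le_rfl
  have hIVT := intermediate_value_Icc' hge hfc.continuousOn
  obtain ⟨β, hβmem, hβeq⟩ := hIVT ⟨hlt.le, by simpa [hf] using hθθ₀.le.trans hstar⟩
  exact ⟨β, hβmem.1, hβeq⟩

/-- Lower bound ⇒ a tuned `M`-adic witness with `β_k → ∞` and EXACT tuning `N_1(k) = θ`. -/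
theorem weakQ_of_lowerBound (r : LatticeRep G) {M : ℕ} (hM : 2 ≤ M)
    (h : ∃ θ₀ : ℝ, 0 < θ₀ ∧ ∀ (B : ℝ) (m₀ L₀ : ℕ), ∃ m : ℕ, m₀ ≤ m ∧ ∃ L : ℕ, L₀ * M ^ m ≤ L ∧
      ∃ β : ℝ, B ≤ β ∧ θ₀ ≤ ((M : ℝ) ^ m) ^ 8 *
        latticeConnectedCorr r.ρ β (2 * L + 1) (spatialPlaquette r) (spatialPlaquette r) (M ^ m)) :
    ∃ θ₀ : ℝ, 0 < θ₀ ∧ ∀ θ : ℝ, 0 < θ → θ < θ₀ →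
      ∃ (sch : SpeciesScheme (YMSpecies G)) (n : ℕ → ℕ),
        (∀ k, sch.a k = ((M : ℝ) ^ n k)⁻¹) ∧ Tendsto sch.β atTop atTop ∧
        Tendsto (fun k => ((M : ℝ) ^ n k) ^ 8 *
            latticeConnectedCorr r.ρ (sch.β k) (sch.side k) (spatialPlaquette r)
              (spatialPlaquette r) (M ^ n k)) atTop (𝓝 θ) := by
  obtain ⟨θ₀, hθ₀, h⟩ := h
  refine ⟨θ₀, hθ₀, fun θ hθ hθθ₀ => ?_⟩
  choose m hm L hL βs hβs hcorr using fun k : ℕ => h (k : ℝ) k k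
  choose β hββs hβeq using fun k : ℕ => exists_ge_corrQ_eq r M (m k) (L k) hθ hθθ₀ (hcorr k)
  have hM1 : (1 : ℝ) < M := by exact_mod_cast hM
  have hm_top : Tendsto m atTop atTop := tendsto_atTop_mono hm tendsto_id
  have hpow_top : Tendsto (fun k => (M : ℝ) ^ m k) atTop atTop :=
    (tendsto_pow_atTop_atTop_of_one_lt hM1).comp hm_top
  let sch : SpeciesScheme (YMSpecies G) :=
    { a := fun k => ((M : ℝ) ^ m k)⁻¹
      a_pos := fun k => by positivity
      tendsto_a := tendsto_inv_atTop_zero.comp hpow_top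
      β := β
      L := L
      tendsto_L := by
        refine tendsto_atTop_mono (fun k => ?_) tendsto_natCast_atTop_atTop
        have hLk : (k : ℝ) * (M : ℝ) ^ m k ≤ L k := by exact_mod_cast hL k
        have hp : (0 : ℝ) < (M : ℝ) ^ m k := by positivity
        show (k : ℝ) ≤ ((M : ℝ) ^ m k)⁻¹ * (L k : ℝ)
        rw [inv_mul_eq_div, le_div_iff₀ hp]
        exact hLk
      c := fun _ _ => 0
      m := fun _ _ => 0 }
  refine ⟨sch, m, fun k => rfl, ?_, ?_⟩
  · exact tendsto_atTop_mono (fun k => (hβs k).trans (hββs k)) tendsto_natCast_atTop_atTop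
  · exact tendsto_const_nhds.congr fun k => (hβeq k).symm

variable {ι : Type} in
/-- Re-indexing a scaling scheme along a strictly increasing map. -/
def reindexQ (sch : SpeciesScheme ι) (φ : ℕ → ℕ) (hφ : StrictMono φ) : SpeciesScheme ι where
  a := sch.a ∘ φ
  a_pos k := sch.a_pos (φ k)
  tendsto_a := sch.tendsto_a.comp hφ.tendsto_atTop
  β := sch.β ∘ φ
  L := sch.L ∘ φ
  tendsto_L := sch.tendsto_L.comp hφ.tendsto_atTop
  c s := sch.c s ∘ φ
  m s := sch.m s ∘ φ

/-- **Clause (iii) for `Q` is free**: along ANY tuned `M`-adic witness with `β_k → ∞`, every `N_t`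
is eventually squeezed in `[0, N_1]` (RP non-negativity + transfer monotonicity), hence bounded, hence
convergent along a diagonal subsequence — no upper-bound stub. -/
theorem windowQ_of_weak (r : LatticeRep G) (M : ℕ) (θ : ℝ) (sch : SpeciesScheme (YMSpecies G))
    (n : ℕ → ℕ) (hshape : ∀ k, sch.a k = ((M : ℝ) ^ n k)⁻¹) (hβ : Tendsto sch.β atTop atTop)
    (hlim : Tendsto (fun k => ((M : ℝ) ^ n k) ^ 8 *
        latticeConnectedCorr r.ρ (sch.β k) (sch.side k) (spatialPlaquette r) (spatialPlaquette r)
          (M ^ n k)) atTop (𝓝 θ)) :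
    ∃ (sch' : SpeciesScheme (YMSpecies G)) (n' : ℕ → ℕ),
      (∀ k, sch'.a k = ((M : ℝ) ^ n' k)⁻¹) ∧ Tendsto sch'.β atTop atTop ∧
      (∀ t : ℕ, 0 < t → ∃ c : ℝ, Tendsto (fun k => ((M : ℝ) ^ n' k) ^ 8 *
          latticeConnectedCorr r.ρ (sch'.β k) (sch'.side k) (spatialPlaquette r) (spatialPlaquette r)
            (t * M ^ n' k)) atTop (𝓝 c)) ∧
      Tendsto (fun k => ((M : ℝ) ^ n' k) ^ 8 *
          latticeConnectedCorr r.ρ (sch'.β k) (sch'.side k) (spatialPlaquette r) (spatialPlaquette r)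
            (M ^ n' k)) atTop (𝓝 θ) := by
  -- `u k t'` := N_{t'+1}(k)
  set u : ℕ → ℕ → ℝ := fun k t' => ((M : ℝ) ^ n k) ^ 8 *
    latticeConnectedCorr r.ρ (sch.β k) (sch.side k) (spatialPlaquette r) (spatialPlaquette r)
      ((t' + 1) * M ^ n k) with hu
  -- a global bound on `N_1`: convergent sequences are bounded
  obtain ⟨K, hK⟩ : ∃ K : ℝ, ∀ k, |((M : ℝ) ^ n k) ^ 8 *
      latticeConnectedCorr r.ρ (sch.β k) (sch.side k) (spatialPlaquette r) (spatialPlaquette r)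
        (M ^ n k)| ≤ K := by
    obtain ⟨K, hK⟩ := hlim.norm.isBoundedUnder_le
    obtain ⟨k₀, hk₀⟩ := eventually_atTop.1 hK
    refine ⟨max K (∑ j ∈ Finset.range k₀, |((M : ℝ) ^ n j) ^ 8 *
      latticeConnectedCorr r.ρ (sch.β j) (sch.side j) (spatialPlaquette r) (spatialPlaquette r)
        (M ^ n j)|), fun k => ?_⟩
    rcases lt_or_ge k k₀ with hk | hk
    · exact le_max_of_le_right (Finset.single_le_sum (f := fun j => |((M : ℝ) ^ n j) ^ 8 *
        latticeConnectedCorr r.ρ (sch.β j) (sch.side j) (spatialPlaquette r) (spatialPlaquette r)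
          (M ^ n j)|) (fun j _ => abs_nonneg _) (Finset.mem_range.2 hk))
    · exact le_max_of_le_left (by simpa [Real.norm_eq_abs] using hk₀ k hk)
  -- each `N_t` is bounded: eventually `0 ≤ N_t ≤ N_1 ≤ K`, finitely many early terms
  have hbdd : ∀ t' : ℕ, ∃ C : ℝ, ∀ k, |u k t'| ≤ C := by
    intro t'
    have hev : ∀ᶠ k in atTop, |u k t'| ≤ K := by
      filter_upwards [tendsto_atTop.1 hβ 0, eventually_sep_le_L sch hshape (t' + 1)] with k hk1 hk2
      have h0 := rescaled_nonneg r hk1 M (n k) (sch.L k) ((t' + 1) * M ^ n k)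
      have h1 := rescaled_mul_le r hk1 M (n k) (sch.L k) (t' + 1) (Nat.succ_pos t') (by omega)
      have h2 := (le_abs_self _).trans (hK k)
      simp only [hu, SpeciesScheme.side]
      rw [abs_of_nonneg h0]
      exact h1.trans h2
    obtain ⟨k₀, hk₀⟩ := eventually_atTop.1 hev
    refine ⟨max K (∑ j ∈ Finset.range k₀, |u j t'|), fun k => ?_⟩
    rcases lt_or_ge k k₀ with hk | hk
    · exact le_max_of_le_right
        (Finset.single_le_sum (fun j _ => abs_nonneg (u j t')) (Finset.mem_range.2 hk))
    · exact le_max_of_le_left (hk₀ k hk)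
  choose C hC using hbdd
  set Kset : Set (ℕ → ℝ) := Set.pi Set.univ fun t' => Set.Icc (-C t') (C t') with hKset
  have hKc : IsCompact Kset := isCompact_univ_pi fun t' => isCompact_Icc
  have huK : ∀ k, u k ∈ Kset := fun k => by
    simp only [hKset, Set.mem_pi, Set.mem_univ, true_implies, Set.mem_Icc]
    intro t'
    exact abs_le.1 (hC t' k)
  obtain ⟨lim, -, φ, hφ, hconv⟩ := hKc.tendsto_subseq huK
  refine ⟨reindexQ sch φ hφ, n ∘ φ, fun k => hshape (φ k), hβ.comp hφ.tendsto_atTop, ?_, ?_⟩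
  · intro t ht
    obtain ⟨t', rfl⟩ := Nat.exists_eq_succ_of_ne_zero ht.ne'
    refine ⟨lim t', ?_⟩
    have h1 : Tendsto (fun j => u (φ j) t') atTop (𝓝 (lim t')) := tendsto_pi_nhds.1 hconv t'
    refine h1.congr fun j => ?_
    simp only [hu, Function.comp_apply, Nat.succ_eq_add_one]
    rfl
  · exact hlim.comp hφ.tendsto_atTop

end GlueQ

/-- **The two-child split of the restated crux**: `(U_Q) → (V_Q) → (S_Q)`, sorry-free, with NO
canonical-upper-bound child — clause (iii) is discharged by reflection positivity
(`windowQ_of_weak`). -/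
theorem tunedSequenceExistsQ_of (hU : FemtoWindowQAll) (hV : VolumeMonotoneQAll) :
    TunedSequenceExistsQ := by
  intro G _ _ _ _ hG
  letI : MeasurableSpace G := borel G
  haveI : BorelSpace G := ⟨rfl⟩
  intro r M hM
  obtain ⟨θ₀, hθ₀, hweak⟩ :=
    weakQ_of_lowerBound r hM (lowerBoundQ_of_femto_of_volume r (hU G hG r M hM) (hV G hG r M hM))
  refine ⟨θ₀, hθ₀, fun θ hθ hθ' => ?_⟩
  obtain ⟨sch, n, hshape, hβ, hlim⟩ := hweak θ hθ hθ'
  exact windowQ_of_weak r M θ sch n hshape hβ hlim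

end Summit.QuantumFields.YangMills.Cruxes.TunedSequenceExists.RPDiagonalVariant

end
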